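import Summits.CriticalPhenomena.PercolationContinuityZ3.Theorems.Transplant.CubicLatticesSkeleton
import Summits.CriticalPhenomena.PercolationContinuityZ3.Theorems.Transplant.StatementPolynomialGrowth
import Literature.Barriers.CriticalPhenomena.BLPSCriticalReduction
import Literature.Barriers.CriticalPhenomena.SubexponentialGrowthZdBurtonKeane
import Literature.Probability.LatticeModels.ThermodynamicLimit
import HarnessLib

/-!
# The cubic lattices have cubic growth, are amenable, and carry a unique infinite cluster at every density (input U for fcc / bcc)

builds on p205010 (kernel theorem, internal audit signed; external expert review pending).
Status sentence (coordinator 2026-08-20T04:30Z): "θ(p_c) = 0 on ℤ^d, all d ≥ 2 — kernel-verified (Lean 4/Mathlib,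
standard axioms); internal adversarial audit SIGNED 2026-08-20 04:29Z; external expert review pending."

Lane `prim-bschramm-*`, seat `prim-bschramm-stmt` (`README.md` transplant table, row U for FCC/BCC: "generic `BurtonKeane1989_…_holds` + amenability of
the instance"; `BLUEPRINT-I-PHI.md` §1 Lemma 7: "U is an INPUT").  PROOF-ONLY (nothing in this file uses p205010):

* `distSqGraph_abs_sub_le_length_of_walk` / `ballVolume_distSqGraph_induce_le` — in every induced distance graph `(distSqGraph d m).induce S` with
  `m < 4` a walk of length `n` moves each coordinate by `≤ n`, so `|B(x,n)| ≤ (2n+1)^d` (the ball injects into the box `x + Λ_n`);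
* `distSqGraph_induce_not_hasExponentialGrowth`, and — for quasi-transitive instances — `…_isGraphAmenable` (Lyons–Peres §6.1 contrapositive,
  tree `hasExponentialGrowth_of_not_isGraphAmenable`) and `…_numInfiniteClusters_le_one` (Burton–Keane for connected quasi-transitive amenable
  graphs, tree `BurtonKeane1989_atMostOneInfiniteCluster_holds`);
* instances: `fcc_ballVolume_le`, `fcc_polynomialGrowth` (`C = 8`, `D = 3`), `fcc_not_hasExponentialGrowth`, **`fcc_isGraphAmenable`**,
  **`fcc_numInfiniteClusters_le_one`** (uniqueness of the infinite cluster on fcc at every `p`), and the same five for bcc; hence the fcc/bcc targets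
  are instances of all three spellings of Conjecture 4's open residue (`fccOwnCriticalContinuity_of_conj4_polynomialGrowth`,
  `…_of_conj4_amenableSubexponential`, and bcc).
[cite: LyonsPeres2016, §6.1 (p. 279) and Thm. 7.6] [cite: BurtonKeane1989, Thm. 2] [cite: ConwaySloane1999, Ch. 4 §7.1]
-/

noncomputable section

namespace Summit.CriticalPhenomena.PercolationContinuityZ3.Theorems.Transplant

open MeasureTheory Filter Literature.Probability.Percolation Literature.Probability.LatticeModels
open Literature.Barriers.CriticalPhenomena (IsQuasiTransitive IsGraphAmenable HasExponentialGrowth graphBall ballVolume graphBall_finite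
  hasExponentialGrowth_of_not_isGraphAmenable eventually_pow_lt_const_pow BurtonKeane1989_atMostOneInfiniteCluster_holds)

/-! ## Cubic growth of induced distance graphs with short steps -/

/-- Along a walk of length `n` in `(distSqGraph d m).induce S`, `m < 4`, every coordinate moves by at most `n`. [folklore] -/
theorem distSqGraph_abs_sub_le_length_of_walk {d : ℕ} {m : ℤ} (hm : m < 4) {S : Set (Site d)} {x y : S}
    (w : ((distSqGraph d m).induce S).Walk x y) (i : Fin d) : |(y : Site d) i - (x : Site d) i| ≤ (w.length : ℤ) := by
  induction w with
  | nil => simp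
  | @cons a b c hab w ih =>
    have hab' : (distSqGraph d m).Adj (a : Site d) (b : Site d) := hab
    have h1 : |(b : Site d) i - (a : Site d) i| ≤ 1 := by
      rw [abs_sub_comm]; exact distSqGraph_abs_sub_le_one hm hab' i
    have h2 : |(c : Site d) i - (a : Site d) i| ≤ |(c : Site d) i - (b : Site d) i| + |(b : Site d) i - (a : Site d) i| := by
      have := abs_sub_le ((c : Site d) i) ((b : Site d) i) ((a : Site d) i)
      linarith
    simp only [SimpleGraph.Walk.length_cons, Nat.cast_add, Nat.cast_one]
    linarith

/-- **Cubic growth**: `|B(x,n)| ≤ (2n+1)^d` in `(distSqGraph d m).induce S`, `m < 4` (the ball, translated by `−x`, injects into the box `Λ_n`).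
[cite: LyonsPeres2016, §6.1 (growth of balls)] -/
theorem ballVolume_distSqGraph_induce_le {d : ℕ} {m : ℤ} (hm : m < 4) (S : Set (Site d)) (x : S) (n : ℕ) :
    ballVolume ((distSqGraph d m).induce S) x n ≤ (2 * n + 1) ^ d := by
  set f : S → Site d := fun y => (y : Site d) - (x : Site d) with hf
  have hinj : Function.Injective f := fun y z h => Subtype.ext (sub_left_injective h)
  have hsub : f '' graphBall ((distSqGraph d m).induce S) x n ⊆ (↑(box d n) : Set (Site d)) := by
    rintro _ ⟨y, ⟨w, hw⟩, rfl⟩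
    rw [Finset.mem_coe, mem_box]
    intro i
    have h := distSqGraph_abs_sub_le_length_of_walk hm w i
    have hn : (w.length : ℤ) ≤ n := by exact_mod_cast hw
    simp only [hf, Pi.sub_apply]
    constructor <;> linarith [(abs_le.1 (h.trans hn)).1, (abs_le.1 (h.trans hn)).2]
  unfold ballVolume
  rw [← Set.ncard_image_of_injective _ hinj, ← card_box d n, ← Set.ncard_coe_finset]
  exact Set.ncard_le_ncard hsub (box d n).finite_toSet

/-- **No exponential growth** for `(distSqGraph d m).induce S`, `m < 4`, `S` non-empty. [cite: Hutchcroft2016, §1 (exponential growth)] -/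
theorem distSqGraph_induce_not_hasExponentialGrowth {d : ℕ} {m : ℤ} (hm : m < 4) (S : Set (Site d)) (x : S) :
    ¬ HasExponentialGrowth ((distSqGraph d m).induce S) := by
  intro h
  obtain ⟨c, hc, hev⟩ := h x
  obtain ⟨n, hn1, hn2⟩ := (hev.and (eventually_pow_lt_const_pow d hc)).exists
  have hvol : (ballVolume ((distSqGraph d m).induce S) x n : ℝ) ≤ (2 * n + 1) ^ d := by
    exact_mod_cast ballVolume_distSqGraph_induce_le hm S x n
  linarith

/-- **Amenability** of a quasi-transitive `(distSqGraph d m).induce S`, `m < 4` (subexponential growth; Lyons–Peres §6.1 contrapositive).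
[cite: LyonsPeres2016, §6.1 (p. 279)] -/
theorem distSqGraph_induce_isGraphAmenable {d : ℕ} {m : ℤ} (hm : m < 4) (S : Set (Site d)) (x : S)
    (hq : IsQuasiTransitive ((distSqGraph d m).induce S)) : IsGraphAmenable ((distSqGraph d m).induce S) := by
  classical
  by_contra h
  exact distSqGraph_induce_not_hasExponentialGrowth hm S x (hasExponentialGrowth_of_not_isGraphAmenable _ hq h)

/-- **Uniqueness of the infinite cluster** at every density on a connected quasi-transitive `(distSqGraph d m).induce S`, `m < 4` (Burton–Keane for
amenable quasi-transitive graphs, tree `BurtonKeane1989_atMostOneInfiniteCluster_holds`). [cite: BurtonKeane1989, Thm. 2] [cite: LyonsPeres2016, Thm. 7.6] -/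
theorem distSqGraph_induce_numInfiniteClusters_le_one {d : ℕ} {m : ℤ} (hm : m < 4) (S : Set (Site d)) (x : S)
    (hc : ((distSqGraph d m).induce S).Connected) (hq : IsQuasiTransitive ((distSqGraph d m).induce S)) (p : unitInterval) :
    ∀ᵐ ω ∂(bondPercolation ((distSqGraph d m).induce S) p), numInfiniteClusters ω ≤ 1 := by
  classical
  exact BurtonKeane1989_atMostOneInfiniteCluster_holds _ hc hq (distSqGraph_induce_isGraphAmenable hm S x hq) p

/-! ## fcc -/

/-- `|B_{fcc}(x,n)| ≤ (2n+1)³`. [cite: ConwaySloane1999, Ch. 4 §7.1] -/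
theorem fcc_ballVolume_le (x : fccSite) (n : ℕ) : ballVolume fccGraph x n ≤ (2 * n + 1) ^ 3 :=
  ballVolume_distSqGraph_induce_le (by norm_num) fccSite x n

/-- fcc has uniform polynomial growth (`C = 8`, `D = 3`), the hypothesis of `BenjaminiSchramm1996_conj4_polynomialGrowth`. [cite: ConwaySloane1999, Ch. 4 §7.1] -/
theorem fcc_polynomialGrowth : ∃ C D : ℝ, ∀ (x : fccSite) (n : ℕ), (ballVolume fccGraph x n : ℝ) ≤ C * ((n : ℝ) + 1) ^ D := by
  refine ⟨8, ((3 : ℕ) : ℝ), fun x n => ?_⟩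
  rw [Real.rpow_natCast]
  have h1 : (ballVolume fccGraph x n : ℝ) ≤ (2 * n + 1) ^ 3 := by exact_mod_cast fcc_ballVolume_le x n
  have h2 : ((2 : ℝ) * n + 1) ^ 3 ≤ 8 * ((n : ℝ) + 1) ^ 3 := by
    have : (2 : ℝ) * n + 1 ≤ 2 * ((n : ℝ) + 1) := by linarith
    calc ((2 : ℝ) * n + 1) ^ 3 ≤ (2 * ((n : ℝ) + 1)) ^ 3 := pow_le_pow_left₀ (by positivity) this 3
      _ = 8 * ((n : ℝ) + 1) ^ 3 := by ring
  exact h1.trans h2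

/-- fcc does not have exponential growth (outside Hutchcroft 2016's class). [cite: Hutchcroft2016, Thm. 1] -/
theorem fcc_not_hasExponentialGrowth : ¬ HasExponentialGrowth fccGraph :=
  distSqGraph_induce_not_hasExponentialGrowth (by norm_num) fccSite fccOrigin

/-- **fcc is amenable.** [cite: LyonsPeres2016, §6.1 (p. 279)] -/
theorem fcc_isGraphAmenable : IsGraphAmenable fccGraph := by
  classical
  exact distSqGraph_induce_isGraphAmenable (by norm_num) fccSite fccOrigin
    (isQuasiTransitive_of_isPretransitive fccGraph fccOrigin isPretransitive_aut_fcc)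

/-- **Uniqueness of the infinite cluster on fcc at every `p`** (input U of the transplant for fcc). [cite: BurtonKeane1989, Thm. 2] [cite: LyonsPeres2016, Thm. 7.6] -/
theorem fcc_numInfiniteClusters_le_one (p : unitInterval) : ∀ᵐ ω ∂(bondPercolation fccGraph p), numInfiniteClusters ω ≤ 1 :=
  distSqGraph_induce_numInfiniteClusters_le_one (by norm_num) fccSite fccOrigin fccGraph_connected
    (isQuasiTransitive_of_isPretransitive fccGraph fccOrigin isPretransitive_aut_fcc) p

/-- The fcc target is an instance of the polynomial-growth spelling of Conjecture 4. [cite: BenjaminiSchramm1996, Conj. 4] -/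
theorem fccOwnCriticalContinuity_of_conj4_polynomialGrowth (h : BenjaminiSchramm1996_conj4_polynomialGrowth) : FccOwnCriticalContinuity :=
  h fccGraph fccGraph_connected (isQuasiTransitive_of_isPretransitive fccGraph fccOrigin isPretransitive_aut_fcc) fcc_polynomialGrowth fccOrigin
    criticalProb_fcc_lt_one

/-- The fcc target is an instance of the amenable-subexponential spelling of Conjecture 4 (THE open residue in print). [cite: BenjaminiSchramm1996, Conj. 4] -/
theorem fccOwnCriticalContinuity_of_conj4_amenableSubexponential (h : BenjaminiSchramm1996_conj4_amenableSubexponential) :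
    FccOwnCriticalContinuity := by
  classical
  exact h fccGraph fccGraph_connected (isQuasiTransitive_of_isPretransitive fccGraph fccOrigin isPretransitive_aut_fcc) fcc_isGraphAmenable
    fcc_not_hasExponentialGrowth fccOrigin criticalProb_fcc_lt_one

/-! ## bcc -/

/-- `|B_{bcc}(x,n)| ≤ (2n+1)³`. [cite: ConwaySloane1999, Ch. 4 §7.1] -/
theorem bcc_ballVolume_le (x : bccSite) (n : ℕ) : ballVolume bccGraph x n ≤ (2 * n + 1) ^ 3 :=
  ballVolume_distSqGraph_induce_le (by norm_num) bccSite x n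

/-- bcc has uniform polynomial growth (`C = 8`, `D = 3`). [cite: ConwaySloane1999, Ch. 4 §7.1] -/
theorem bcc_polynomialGrowth : ∃ C D : ℝ, ∀ (x : bccSite) (n : ℕ), (ballVolume bccGraph x n : ℝ) ≤ C * ((n : ℝ) + 1) ^ D := by
  refine ⟨8, ((3 : ℕ) : ℝ), fun x n => ?_⟩
  rw [Real.rpow_natCast]
  have h1 : (ballVolume bccGraph x n : ℝ) ≤ (2 * n + 1) ^ 3 := by exact_mod_cast bcc_ballVolume_le x n
  have h2 : ((2 : ℝ) * n + 1) ^ 3 ≤ 8 * ((n : ℝ) + 1) ^ 3 := by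
    have : (2 : ℝ) * n + 1 ≤ 2 * ((n : ℝ) + 1) := by linarith
    calc ((2 : ℝ) * n + 1) ^ 3 ≤ (2 * ((n : ℝ) + 1)) ^ 3 := pow_le_pow_left₀ (by positivity) this 3
      _ = 8 * ((n : ℝ) + 1) ^ 3 := by ring
  exact h1.trans h2

/-- bcc does not have exponential growth. [cite: Hutchcroft2016, Thm. 1] -/
theorem bcc_not_hasExponentialGrowth : ¬ HasExponentialGrowth bccGraph :=
  distSqGraph_induce_not_hasExponentialGrowth (by norm_num) bccSite bccOrigin

/-- **bcc is amenable.** [cite: LyonsPeres2016, §6.1 (p. 279)] -/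
theorem bcc_isGraphAmenable : IsGraphAmenable bccGraph := by
  classical
  exact distSqGraph_induce_isGraphAmenable (by norm_num) bccSite bccOrigin
    (isQuasiTransitive_of_isPretransitive bccGraph bccOrigin isPretransitive_aut_bcc)

/-- **Uniqueness of the infinite cluster on bcc at every `p`** (input U for bcc). [cite: BurtonKeane1989, Thm. 2] [cite: LyonsPeres2016, Thm. 7.6] -/
theorem bcc_numInfiniteClusters_le_one (p : unitInterval) : ∀ᵐ ω ∂(bondPercolation bccGraph p), numInfiniteClusters ω ≤ 1 :=
  distSqGraph_induce_numInfiniteClusters_le_one (by norm_num) bccSite bccOrigin bccGraph_connected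
    (isQuasiTransitive_of_isPretransitive bccGraph bccOrigin isPretransitive_aut_bcc) p

/-- The bcc target is an instance of the polynomial-growth spelling of Conjecture 4. [cite: BenjaminiSchramm1996, Conj. 4] -/
theorem bccOwnCriticalContinuity_of_conj4_polynomialGrowth (h : BenjaminiSchramm1996_conj4_polynomialGrowth) : BccOwnCriticalContinuity :=
  h bccGraph bccGraph_connected (isQuasiTransitive_of_isPretransitive bccGraph bccOrigin isPretransitive_aut_bcc) bcc_polynomialGrowth bccOrigin
    criticalProb_bcc_lt_one

/-- The bcc target is an instance of the amenable-subexponential spelling of Conjecture 4. [cite: BenjaminiSchramm1996, Conj. 4] -/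
theorem bccOwnCriticalContinuity_of_conj4_amenableSubexponential (h : BenjaminiSchramm1996_conj4_amenableSubexponential) :
    BccOwnCriticalContinuity := by
  classical
  exact h bccGraph bccGraph_connected (isQuasiTransitive_of_isPretransitive bccGraph bccOrigin isPretransitive_aut_bcc) bcc_isGraphAmenable
    bcc_not_hasExponentialGrowth bccOrigin criticalProb_bcc_lt_one

end Summit.CriticalPhenomena.PercolationContinuityZ3.Theorems.Transplant
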